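import Mathlib
import HarnessLib
import Summits.MatrixMultiplication.MatrixMultiplication.Theorems.OutsiderSandwichToricCeilingPow

/-!
# OutsiderSandwich — tight-frame toric ceiling `⟨3^N - 2⟩`, part 1/5: perfect matchings of a
complement and the slicing glue
(decomp-mm lens 4, gen 45, kernel K45; THESES-FREE, `ω`-free; helper toward `LaserTangency`,
stmt-32268 — the extremal subrank/packing cells of the literal host `kroneckerPow (cwTensor ℂ 2) N`)

LABEL.  TORIC · uniform in `N` · NEC-side instrument; infrastructure only (no statement about
`cw₂^{⊠N}` is decided in this part).  The theorem is part 5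
(`…ToricCeilingPowSubTwo.tightFrame_pow_no_diagonal_comb_degeneration_sub_two`), whose docstring
describes the whole argument.

WHAT.  For the tight power frame `D_m = frame (fun _ => false)` of words `Fin m → Fin 3`:
* `isPM P X Y Z` (Boolean): `P ⊆ D_m` is a diagonal-free (leg-injective) perfect matching of the
  complement of the word sets `X, Y, Z` on the legs `A, B, C`; `isPM_iff`; rotation of the legs
  (`rot`, `isPM_rot`, `twoPM_rot`).
* SLICING at a pivot coordinate `p` (`ins = Fin.insertNth`, `tl = Fin.removeNth`, `layer`, `lift3`):
  `glue p d Aux Q` is the union of a set `Aux` of AUXILIARY triples and, for each letter `a`, the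
  lift of a tail matching `Q a` into the LAYER SLOT `(a, a+d, a+2d)`; `isPM_glue`: if `Aux ⊆ D`
  is leg-injective, avoids `X, Y, Z`, and each `Q a` is a perfect matching of the slot's layers
  minus `X, Y, Z` and minus the `Aux` vertices, then the glue is a perfect matching of the
  complement of `X, Y, Z`; `glue_dir` (non-auxiliary triples have direction `d`), `glue_inj`
  (a glue with auxiliary triples of direction `2d` determines `Aux` and every `Q a`).
All definitions are plain data (`Bool` / `Finset` / word-valued).
-/

set_option linter.dupNamespace false

namespace Summit.MatrixMultiplication.MatrixMultiplication.Theorems.OutsiderSandwichToricCeilingPowSubTwoGlue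

open Finset
open Summit.MatrixMultiplication.MatrixMultiplication.Theorems.OutsiderSandwichToricCeiling (dSlot)
open Summit.MatrixMultiplication.MatrixMultiplication.Theorems.OutsiderSandwichToricCeilingPowFibres
  (Word Tr3 slotB frame)

variable {m : ℕ}

/-! ## §1 Letter facts in `Fin 3` and the tight frame -/

/-- The three letters `a, a+d, a+2d` of a tight row with `d ≠ 0` are pairwise distinct. -/
theorem F3.tr_ne : ∀ a d : Fin 3, d ≠ 0 → a ≠ a + d ∧ a + d ≠ a + (d + d) ∧ a ≠ a + (d + d) := by
  decide

/-- Letters in `Fin 3`: `a ≠ b` lifts along `+d`. -/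
theorem F3.lift_ne : ∀ a d : Fin 3, d ≠ 0 → a ≠ a + d ∧ a + d ≠ a + d + d ∧ a ≠ a + d + d := by
  decide

/-- Every letter of `Fin 3` is `0`, `1` or `2`. -/
theorem F3.cases3 : ∀ a d a' : Fin 3, d ≠ 0 → a' = a ∨ a' = a + d ∨ a' = a + d + d := by decide

/-- A nonzero direction of `Fin 3` is `1` or `2`. -/
theorem F3.dir_ne : ∀ a d : Fin 3, d ≠ 0 → a + d ≠ a + (d + d) := by decide

/-- `3 • a = 0` in `Fin 3`, written additively. -/
theorem F3.add3 : ∀ a d : Fin 3, a + d + d + d = a := by decide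

/-- `a + 1 ≠ a + 2` in `Fin 3`. -/
theorem F3.add_one_ne : ∀ a : Fin 3, a + 1 ≠ a := by decide

/-- Doubling a nonzero direction: `d + d` is the other nonzero direction. -/
theorem F3.dir2 : ∀ ξ e : Fin 3, ξ + e + e = ξ + (e + e) ∧ ξ = ξ + e + (e + e) ∧
    ξ + e = ξ + e + e + (e + e) := by decide

/-- The third letter of a tight row is determined by the other two. -/
theorem F3.third : ∀ a b c : Fin 3, a ≠ b → b ≠ c → a ≠ c →
    b - a ≠ 0 ∧ a + (b - a) = b ∧ a + (b - a) + (b - a) = c ∧ a + (b - a) + (b - a) + (b - a) = a ∧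
      a + ((b - a) + (b - a)) = c := by
  decide

/-- Membership in the TIGHT FRAME `frame (fun _ => false)` (every coordinate in the permutation
basis): the three letters are distinct at every coordinate. -/
theorem mem_tfr {t : Tr3 m} : t ∈ frame (fun _ : Fin m => false) ↔
    ∀ i, t.1 i ≠ t.2.1 i ∧ t.2.1 i ≠ t.2.2 i ∧ t.1 i ≠ t.2.2 i := by
  simp [frame, slotB, dSlot]

/-! ## §2 Perfect matchings of a complement -/

/-- `P` is a PERFECT MATCHING of the tight frame with the vertex sets `X, Y, Z` removed: a
leg-injective set of tight-frame triples whose leg images are exactly the complements of `X`, `Y`,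
`Z` (Boolean form; unfolded by `isPM_iff`). [new] -/
def isPM (P : Finset (Tr3 m)) (X Y Z : Finset (Word m)) : Bool :=
  decide (P ⊆ frame (fun _ : Fin m => false) ∧
    #(P.image fun t => t.1) = #P ∧ #(P.image fun t => t.2.1) = #P ∧ #(P.image fun t => t.2.2) = #P ∧
    P.image (fun t => t.1) = univ \ X ∧ P.image (fun t => t.2.1) = univ \ Y ∧
    P.image (fun t => t.2.2) = univ \ Z)

/-- `isPM` unfolded: sub-frame, the three leg images are the complements, leg-injective. -/
theorem isPM_iff {P : Finset (Tr3 m)} {X Y Z : Finset (Word m)} : isPM P X Y Z = true ↔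
    P ⊆ frame (fun _ : Fin m => false) ∧
    Set.InjOn (fun t : Tr3 m => t.1) P ∧ Set.InjOn (fun t : Tr3 m => t.2.1) P ∧
    Set.InjOn (fun t : Tr3 m => t.2.2) P ∧
    P.image (fun t => t.1) = univ \ X ∧ P.image (fun t => t.2.1) = univ \ Y ∧
    P.image (fun t => t.2.2) = univ \ Z := by
  rw [isPM, decide_eq_true_iff, card_image_iff, card_image_iff, card_image_iff]

/-- Cyclic rotation of the legs `(A, B, C) ↦ (B, C, A)`. [new] -/
def rot (t : Tr3 m) : Tr3 m := (t.2.1, t.2.2, t.1)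

/-- Rotating the legs of a triple is injective. -/
theorem rot_injective : Function.Injective (rot (m := m)) := by
  rintro ⟨u, v, w⟩ ⟨u', v', w'⟩ h
  simp only [rot, Prod.mk.injEq] at h
  obtain ⟨rfl, rfl, rfl⟩ := h
  rfl

/-- Rotating the legs `(A, B, C) ↦ (B, C, A)` of a perfect matching of the complement of
`(X, Y, Z)` gives one of the complement of `(Y, Z, X)` (the tight frame is rotation invariant). -/
theorem isPM_rot {P : Finset (Tr3 m)} {X Y Z : Finset (Word m)} (h : isPM P X Y Z = true) :
    isPM (P.image rot) Y Z X = true := by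
  obtain ⟨hsub, j₁, j₂, j₃, i₁, i₂, i₃⟩ := isPM_iff.1 h
  rw [isPM_iff]
  refine ⟨?_, ?_, ?_, ?_, ?_, ?_, ?_⟩
  · intro s hs
    rw [mem_image] at hs
    obtain ⟨t, ht, rfl⟩ := hs
    have hf := mem_tfr.1 (hsub ht)
    rw [mem_tfr]
    intro i
    obtain ⟨h1, h2, h3⟩ := hf i
    exact ⟨h2, h3.symm, h1.symm⟩
  · intro s hs s' hs' e
    simp only [coe_image, Set.mem_image, mem_coe] at hs hs'
    obtain ⟨t, ht, rfl⟩ := hs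
    obtain ⟨t', ht', rfl⟩ := hs'
    rw [j₂ ht ht' e]
  · intro s hs s' hs' e
    simp only [coe_image, Set.mem_image, mem_coe] at hs hs'
    obtain ⟨t, ht, rfl⟩ := hs
    obtain ⟨t', ht', rfl⟩ := hs'
    rw [j₃ ht ht' e]
  · intro s hs s' hs' e
    simp only [coe_image, Set.mem_image, mem_coe] at hs hs'
    obtain ⟨t, ht, rfl⟩ := hs
    obtain ⟨t', ht', rfl⟩ := hs'
    rw [j₁ ht ht' e]
  · rw [image_image]; exact i₂
  · rw [image_image]; exact i₃
  · rw [image_image]; exact i₁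

/-- TWO DISTINCT perfect matchings transport under the rotation. -/
theorem twoPM_rot {X Y Z : Finset (Word m)}
    (h : ∃ P₁ P₂, P₁ ≠ P₂ ∧ isPM P₁ X Y Z = true ∧ isPM P₂ X Y Z = true) :
    ∃ P₁ P₂, P₁ ≠ P₂ ∧ isPM P₁ Y Z X = true ∧ isPM P₂ Y Z X = true := by
  obtain ⟨P₁, P₂, hne, h₁, h₂⟩ := h
  exact ⟨P₁.image rot, P₂.image rot, fun e => hne (image_injective rot_injective e), isPM_rot h₁,
    isPM_rot h₂⟩

/-! ## §4 Slicing at a pivot coordinate -/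

/-- Insert the letter `a` at the pivot coordinate `p`. [new] -/
def ins (p : Fin (m + 1)) (a : Fin 3) (u : Word m) : Word (m + 1) :=
  Fin.insertNth (α := fun _ => Fin 3) p a u

/-- Delete the pivot coordinate `p` (the TAIL of a word). [new] -/
def tl (p : Fin (m + 1)) (w : Word (m + 1)) : Word m := Fin.removeNth (α := fun _ => Fin 3) p w

/-- `ins p a w` has letter `a` at the pivot `p`. -/
@[simp] theorem ins_apply_same (p : Fin (m + 1)) (a : Fin 3) (u : Word m) : ins p a u p = a :=
  Fin.insertNth_apply_same _ _ _

/-- `ins p a w` has the letters of `w` off the pivot. -/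
@[simp] theorem ins_apply_succAbove (p : Fin (m + 1)) (a : Fin 3) (u : Word m) (j : Fin m) :
    ins p a u (p.succAbove j) = u j :=
  Fin.insertNth_apply_succAbove _ _ _ _

/-- The tail `tl p u` reads `u` off the pivot. -/
@[simp] theorem tl_apply (p : Fin (m + 1)) (w : Word (m + 1)) (j : Fin m) :
    tl p w j = w (p.succAbove j) := rfl

/-- Tail of an insertion. -/
@[simp] theorem tl_ins (p : Fin (m + 1)) (a : Fin 3) (u : Word m) : tl p (ins p a u) = u :=
  Fin.removeNth_insertNth _ _ _

/-- A word is the insertion of its pivot letter into its tail. -/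
@[simp] theorem ins_tl (p : Fin (m + 1)) (w : Word (m + 1)) : ins p (w p) (tl p w) = w :=
  Fin.insertNth_self_removeNth _ _

/-- `ins p a w = u` iff `u` has pivot letter `a` and tail `w`. -/
theorem ins_eq_iff {p : Fin (m + 1)} {a : Fin 3} {u : Word m} {w : Word (m + 1)} :
    ins p a u = w ↔ a = w p ∧ u = tl p w :=
  Fin.insertNth_eq_iff

/-- Insertion at a pivot is injective in (letter, tail). -/
@[simp] theorem ins_inj {p : Fin (m + 1)} {a a' : Fin 3} {u u' : Word m} :
    ins p a u = ins p a' u' ↔ a = a' ∧ u = u' := by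
  rw [ins_eq_iff, ins_apply_same, tl_ins]

/-- Three tight-frame words with prescribed pivot letters. -/
theorem mk3_mem_tfr {p : Fin (m + 1)} {a b c : Fin 3} {u v w : Word m} :
    ((ins p a u, ins p b v, ins p c w) : Tr3 (m + 1)) ∈ frame (fun _ : Fin (m + 1) => false) ↔
      (a ≠ b ∧ b ≠ c ∧ a ≠ c) ∧ ∀ j, u j ≠ v j ∧ v j ≠ w j ∧ u j ≠ w j := by
  rw [mem_tfr, Fin.forall_iff_succAbove p]
  simp

/-- Lift a triple of tails into the slot with pivot letters `(a, b, c)`. [new] -/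
def lift3 (p : Fin (m + 1)) (a b c : Fin 3) (s : Tr3 m) : Tr3 (m + 1) :=
  (ins p a s.1, ins p b s.2.1, ins p c s.2.2)

/-- Lifting a tail triple into a slot is injective. -/
theorem lift3_inj {p : Fin (m + 1)} {a b c a' b' c' : Fin 3} {s s' : Tr3 m} :
    lift3 p a b c s = lift3 p a' b' c' s' ↔ (a = a' ∧ b = b' ∧ c = c') ∧ s = s' := by
  simp only [lift3, ins_inj, Prod.ext_iff]
  tauto

/-- A lifted triple is tight iff the slot letters form a tight row and the tail triple is tight. -/
theorem lift3_mem_tfr {p : Fin (m + 1)} {a b c : Fin 3} {s : Tr3 m} :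
    lift3 p a b c s ∈ frame (fun _ : Fin (m + 1) => false) ↔
      (a ≠ b ∧ b ≠ c ∧ a ≠ c) ∧ s ∈ frame (fun _ : Fin m => false) := by
  rw [lift3, mk3_mem_tfr, mem_tfr]

/-- The LAYER of letter `a` at the pivot `p` of a set of words, as a set of tails. [new] -/
def layer (p : Fin (m + 1)) (a : Fin 3) (S : Finset (Word (m + 1))) : Finset (Word m) :=
  (S.filter fun w => w p = a).image (tl p)

/-- Membership in a layer: pivot letter `a`, tail in `S`. -/
@[simp] theorem mem_layer {p : Fin (m + 1)} {a : Fin 3} {S : Finset (Word (m + 1))} {u : Word m} :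
    u ∈ layer p a S ↔ ins p a u ∈ S := by
  constructor
  · intro h
    rw [layer, mem_image] at h
    obtain ⟨w, hw, rfl⟩ := h
    rw [mem_filter] at hw
    rw [← hw.2, ins_tl]
    exact hw.1
  · intro h
    rw [layer, mem_image]
    exact ⟨ins p a u, mem_filter.2 ⟨h, ins_apply_same _ _ _⟩, tl_ins _ _ _⟩

/-- THE GLUE: auxiliary triples plus, for every pivot letter `a`, the sub-matching `Q a` lifted into
the slot `(a, a + d, a + 2d)` of the primary direction `d`. [new] -/
def glue (p : Fin (m + 1)) (d : Fin 3) (Aux : Finset (Tr3 (m + 1))) (Q : Fin 3 → Finset (Tr3 m)) :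
    Finset (Tr3 (m + 1)) :=
  Aux ∪ univ.biUnion fun a => (Q a).image (lift3 p a (a + d) (a + d + d))

/-- Membership in a glue: an auxiliary triple, or a lift of some `Q a` into the slot of `a`. -/
theorem mem_glue {p : Fin (m + 1)} {d : Fin 3} {Aux : Finset (Tr3 (m + 1))}
    {Q : Fin 3 → Finset (Tr3 m)} {t : Tr3 (m + 1)} :
    t ∈ glue p d Aux Q ↔ t ∈ Aux ∨ ∃ a, ∃ s ∈ Q a, lift3 p a (a + d) (a + d + d) s = t := by
  simp [glue]

/-- A lift into the slot of `a` lies in the glue iff it is auxiliary or comes from `Q a`. -/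
theorem lift_mem_glue {p : Fin (m + 1)} {d : Fin 3} {Aux : Finset (Tr3 (m + 1))}
    {Q : Fin 3 → Finset (Tr3 m)} {a : Fin 3} {s : Tr3 m} (hs : s ∈ Q a) :
    lift3 p a (a + d) (a + d + d) s ∈ glue p d Aux Q :=
  mem_glue.2 (Or.inr ⟨a, s, hs, rfl⟩)

/-- One leg of the glue: injectivity and image, for a leg projection `πM / πm` whose slot letter
over the pivot letter `a` is `e a`. -/
theorem glue_leg {p : Fin (m + 1)} {d : Fin 3} {Aux : Finset (Tr3 (m + 1))}
    {Q : Fin 3 → Finset (Tr3 m)} {πM : Tr3 (m + 1) → Word (m + 1)} {πm : Tr3 m → Word m}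
    {e : Fin 3 → Fin 3} (he : Function.Injective e)
    (hπ : ∀ a s, πM (lift3 p a (a + d) (a + d + d) s) = ins p (e a) (πm s))
    (V : Finset (Word (m + 1))) (jA : Set.InjOn πM Aux) (hAV : ∀ t ∈ Aux, πM t ∉ V)
    (hQj : ∀ a, Set.InjOn πm (Q a))
    (hQi : ∀ a, (Q a).image πm = univ \ layer p (e a) (V ∪ Aux.image πM)) :
    Set.InjOn πM (glue p d Aux Q) ∧ (glue p d Aux Q).image πM = univ \ V := by
  have hes : Function.Surjective e := Finite.surjective_of_injective he
  -- a lifted vertex is never an auxiliary vertex nor in `V`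
  have key : ∀ a, ∀ s ∈ Q a, ins p (e a) (πm s) ∉ V ∧ ins p (e a) (πm s) ∉ Aux.image πM := by
    intro a s hs
    have h1 : πm s ∈ (Q a).image πm := mem_image_of_mem _ hs
    rw [hQi a, mem_sdiff, mem_layer, mem_union, not_or] at h1
    exact h1.2
  constructor
  · intro t ht t' ht' hq
    rw [mem_coe, mem_glue] at ht ht'
    rcases ht with ht | ⟨a, s, hs, rfl⟩ <;> rcases ht' with ht' | ⟨a', s', hs', rfl⟩
    · exact jA ht ht' hq
    · exact absurd (mem_image_of_mem πM ht) (by rw [hq, hπ]; exact (key a' s' hs').2)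
    · exact absurd (mem_image_of_mem πM ht') (by rw [← hq, hπ]; exact (key a s hs).2)
    · rw [hπ, hπ, ins_inj] at hq
      obtain ⟨h1, h2⟩ := hq
      obtain rfl := he h1
      rw [hQj a hs hs' h2]
  · ext w
    rw [mem_image, mem_sdiff]
    constructor
    · rintro ⟨t, ht, rfl⟩
      refine ⟨mem_univ _, ?_⟩
      rw [mem_glue] at ht
      rcases ht with ht | ⟨a, s, hs, rfl⟩
      · exact hAV t ht
      · rw [hπ]; exact (key a s hs).1
    · rintro ⟨-, hw⟩
      by_cases hwA : w ∈ Aux.image πM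
      · rw [mem_image] at hwA
        obtain ⟨t, ht, rfl⟩ := hwA
        exact ⟨t, mem_glue.2 (Or.inl ht), rfl⟩
      · obtain ⟨a, ha⟩ := hes (w p)
        have hu : tl p w ∈ (Q a).image πm := by
          rw [hQi a, mem_sdiff, mem_layer, ha, ins_tl, mem_union, not_or]
          exact ⟨mem_univ _, hw, hwA⟩
        rw [mem_image] at hu
        obtain ⟨s, hs, hsu⟩ := hu
        exact ⟨_, lift_mem_glue hs, by rw [hπ, hsu, ha, ins_tl]⟩

/-- **The glue is a perfect matching.** -/
theorem isPM_glue {p : Fin (m + 1)} {d : Fin 3} (hd : d ≠ 0) {Aux : Finset (Tr3 (m + 1))}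
    {Q : Fin 3 → Finset (Tr3 m)} {X Y Z : Finset (Word (m + 1))}
    (hAf : Aux ⊆ frame (fun _ : Fin (m + 1) => false))
    (jA₁ : Set.InjOn (fun t : Tr3 (m + 1) => t.1) Aux)
    (jA₂ : Set.InjOn (fun t : Tr3 (m + 1) => t.2.1) Aux)
    (jA₃ : Set.InjOn (fun t : Tr3 (m + 1) => t.2.2) Aux)
    (hAX : ∀ t ∈ Aux, t.1 ∉ X) (hAY : ∀ t ∈ Aux, t.2.1 ∉ Y) (hAZ : ∀ t ∈ Aux, t.2.2 ∉ Z)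
    (hQ : ∀ a, isPM (Q a) (layer p a (X ∪ Aux.image fun t => t.1))
      (layer p (a + d) (Y ∪ Aux.image fun t => t.2.1))
      (layer p (a + d + d) (Z ∪ Aux.image fun t => t.2.2)) = true) :
    isPM (glue p d Aux Q) X Y Z = true := by
  replace hQ := fun a => isPM_iff.1 (hQ a)
  rw [isPM_iff]
  obtain ⟨l₁, i₁⟩ := glue_leg (πM := fun t : Tr3 (m + 1) => t.1) (πm := fun t : Tr3 m => t.1)
    (e := fun a => a) (fun a b h => h) (fun a s => rfl) X jA₁ hAX (fun a => (hQ a).2.1)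
    (fun a => (hQ a).2.2.2.2.1)
  obtain ⟨l₂, i₂⟩ := glue_leg (πM := fun t : Tr3 (m + 1) => t.2.1) (πm := fun t : Tr3 m => t.2.1)
    (e := fun a => a + d) (add_left_injective d) (fun a s => rfl) Y jA₂ hAY
    (fun a => (hQ a).2.2.1) (fun a => (hQ a).2.2.2.2.2.1)
  obtain ⟨l₃, i₃⟩ := glue_leg (πM := fun t : Tr3 (m + 1) => t.2.2) (πm := fun t : Tr3 m => t.2.2)
    (e := fun a => a + d + d) (fun a b h => add_left_injective d (add_left_injective d h))
    (fun a s => rfl) Z jA₃ hAZ (fun a => (hQ a).2.2.2.1) (fun a => (hQ a).2.2.2.2.2.2)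
  refine ⟨?_, l₁, l₂, l₃, i₁, i₂, i₃⟩
  intro t ht
  rw [mem_glue] at ht
  rcases ht with ht | ⟨a, s, hs, rfl⟩
  · exact hAf ht
  · exact lift3_mem_tfr.2 ⟨F3.lift_ne a d hd, (hQ a).1 hs⟩

/-- In the glue, every non-auxiliary triple lies in a primary slot: `B_p = A_p + d`. -/
theorem glue_dir {p : Fin (m + 1)} {d : Fin 3} {Aux : Finset (Tr3 (m + 1))}
    {Q : Fin 3 → Finset (Tr3 m)} {t : Tr3 (m + 1)} (ht : t ∈ glue p d Aux Q) (hA : t ∉ Aux) :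
    t.2.1 p = t.1 p + d := by
  rw [mem_glue] at ht
  rcases ht with ht | ⟨a, s, hs, rfl⟩
  · exact absurd ht hA
  · simp [lift3]

/-- Glues with the same pivot and primary direction whose auxiliary triples lie in slots of the
other direction `2d` are equal only if their data are equal. -/
theorem glue_sub {p : Fin (m + 1)} {d : Fin 3} (hd : d ≠ 0) {Aux Aux' : Finset (Tr3 (m + 1))}
    {Q Q' : Fin 3 → Finset (Tr3 m)}
    (hdir : ∀ t ∈ Aux, t.2.1 p = t.1 p + (d + d)) (hdir' : ∀ t ∈ Aux', t.2.1 p = t.1 p + (d + d))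
    (h : glue p d Aux Q ⊆ glue p d Aux' Q') : Aux ⊆ Aux' ∧ ∀ a, Q a ⊆ Q' a := by
  constructor
  · intro t ht
    have ht' := mem_glue.1 (h (mem_glue.2 (Or.inl ht)))
    rcases ht' with ht' | ⟨a, s, hs, rfl⟩
    · exact ht'
    · exact absurd (hdir _ ht) (by simpa [lift3] using F3.dir_ne a d hd)
  · intro a s hs
    have ht' := mem_glue.1 (h (lift_mem_glue (Aux := Aux) hs))
    rcases ht' with ht' | ⟨a', s', hs', e⟩
    · exact absurd (hdir' _ ht') (by simpa [lift3] using F3.dir_ne a d hd)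
    · rw [lift3_inj] at e
      obtain ⟨⟨rfl, -, -⟩, rfl⟩ := e
      exact hs'

/-- A glue whose auxiliary triples have direction `d + d` (not `d`) determines `Aux` and
every `Q a`: used to tell two glued matchings apart. -/
theorem glue_inj {p : Fin (m + 1)} {d : Fin 3} (hd : d ≠ 0) {Aux Aux' : Finset (Tr3 (m + 1))}
    {Q Q' : Fin 3 → Finset (Tr3 m)}
    (hdir : ∀ t ∈ Aux, t.2.1 p = t.1 p + (d + d)) (hdir' : ∀ t ∈ Aux', t.2.1 p = t.1 p + (d + d))
    (h : glue p d Aux Q = glue p d Aux' Q') : Aux = Aux' ∧ ∀ a, Q a = Q' a := by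
  obtain ⟨h₁, h₂⟩ := glue_sub hd hdir hdir' h.le
  obtain ⟨h₃, h₄⟩ := glue_sub hd hdir' hdir h.ge
  exact ⟨subset_antisymm h₁ h₃, fun a => subset_antisymm (h₂ a) (h₄ a)⟩

end Summit.MatrixMultiplication.MatrixMultiplication.Theorems.OutsiderSandwichToricCeilingPowSubTwoGlue
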